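import Summits.CriticalPhenomena.PercolationContinuityZ3.Theses.PercAxialLogConvexity

/-!
# Assembly of route PercAxialLogConvexity (item stmt-CriticalPhenomena-11735)

Pure plumbing: the route item `Assembly` is the implication
`AxialLogConvex → BlockCrossover → KinkCriterion → TauLowerThetaSq → PercolationContinuityZ3`,
and the route file's deciding theorem `closes` has exactly these four hypotheses and this
conclusion.
-/

namespace Summit.CriticalPhenomena.PercolationContinuityZ3.Theorems

open Summit.CriticalPhenomena.PercolationContinuityZ3.Theses.PercAxialLogConvexity

/-- The assembly item of route `PercAxialLogConvexity` (stmt-CriticalPhenomena-11735): the four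
route items `AxialLogConvex`, `BlockCrossover`, `KinkCriterion`, `TauLowerThetaSq` imply the
sub-problem statement `PercolationContinuityZ3`, by the route's deciding theorem `closes`. -/
theorem percAxialLogConvexityAssembly_proof :
    Summit.CriticalPhenomena.PercolationContinuityZ3.Theses.PercAxialLogConvexity.Assembly := by
  unfold Summit.CriticalPhenomena.PercolationContinuityZ3.Theses.PercAxialLogConvexity.Assembly
  intro h1 h2 h3 h4
  exact closes h1 h2 h3 h4

end Summit.CriticalPhenomena.PercolationContinuityZ3.Theorems
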